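import Summits.FinalStateConjecture.FinalStateConjecture.Theorems.EIHFluxBalanceInertialRecessionStubIdentificationMain

/-!
# Route EIHFluxBalance — `InertialRecession` (E′), line `SketchCleanExcision`:
# CLEAN EXCISION WITH A RATE IN SCALE for the lab charges (stub `stub_cleanExcision`)

Helper file (`--supports stmt-FinalStateConjecture-17403`) for the crux
`Summit.FinalStateConjecture.FinalStateConjecture.Theses.EIHFluxBalance.InertialRecession`.

`stub_cleanExcision`: granted the pseudotensor bound, under the crux antecedent with `0 < N`, slaving and
quasi-stationarity (the hypotheses, verbatim, of the proved identification
`SublinearIsFree.ChargeModel.cleanWindowCharges_identification`), at EQUAL TIMES the Landau–Lifshitz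
four-momentum of the lab metric through a `δ`-admissible window sphere `(c, R)` in the middle cone minus
the sum of the four-momenta through finitely many `δ`-admissible sub-windows `(c′ₖ, R′ₖ)` nested in it,
pairwise `(1 + δ)`-separated, all radii `≥ Rm ≥ ρ(t)/δ`, carrying every member of the big window, is
`≤ C · (√Rm)⁻¹` with `C = C_PTB K² N 8π δ^{-1/2}`.

Proof: the perforated region `K = B̄(c, R) ∖ ⋃ₖ B(c′ₖ, R′ₖ)` is `δ Rm`-clear of every painted centre and
inside the cone `‖y‖ ≤ κ t`; the perforated Gauss law (`LLGauss.perforatedGauss`, exact, any radii) turns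
the difference of charges into the bulk integral of `Σ_α ∂_α h^{μ0α}` over `K`, which in vacuum is
`(−g) t^{μ0}_LL`, bounded by `C_PTB ‖∂g‖²` (`abs_emComplex_le_of_pseudotensorBound`); the far-field control
`‖∂(lab)‖ ≤ K d^{-7/4}` at clean late cone points (`ChargeModel.sphereConditions`) and the decay integral
(`abs_setIntegral_le_of_decay`) give `C_PTB K² N 8π (δ Rm)^{-1/2}`.
[cite: LandauLifshitz1975, §96 (96.16)–(96.17)]
-/

set_option linter.dupNamespace false
-- instance search on the nested operator spaces needs a deeper pending depth (as in `CoordCurvature.lean`)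
set_option maxSynthPendingDepth 3

noncomputable section

namespace Summit.FinalStateConjecture.FinalStateConjecture.Theorems.SketchCleanExcision

open scoped BigOperators Topology Manifold Classical MeasureTheory Matrix InnerProductSpace ContDiff ENNReal
open Filter Set Function TopologicalSpace MeasureTheory Literature.Geometry.Lorentzian

open Literature.Geometry.Lorentzian.LandauLifshitz SublinearIsFree.ChargeModel SublinearIsFree.PseudotensorBound
  LLBalance in
/-- **The excision estimate at a fixed time, for a general field.** For `g` of class `C^∞`, symmetric and
with vanishing coordinate Ricci form on an open `W ⊆ E4` containing the slice image `{t} × K` of the closed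
perforated ball `K = {|y − c| ≤ R, |y − c′ₖ| ≥ R′ₖ ∀ k}` (holes strictly inside, strictly disjoint), within
`1/2` of `η` there with `‖Dg‖ ≤ K d^{-7/4}`, `d` the distance to the nearest of the `N ≥ 1` centres
`ξᵢ(t)`, all at distance `≥ ρ₀ > 0` from `K`: granted the pseudotensor bound with constant `Cp`,
`|P^μ[g](t; c, R) − Σₖ P^μ[g](t; c′ₖ, R′ₖ)| ≤ Cp K² N 8π ρ₀^{-1/2}`.
[cite: LandauLifshitz1975, §96 (96.16)–(96.17)] -/
theorem excision_estimate {N : ℕ} (hN : 0 < N) (ξ : Fin N → ℝ → E3) {Cp K : ℝ} (hCp0 : 0 ≤ Cp)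
    (hPTB : ∀ (g : E4 → E4 →L[ℝ] E4 →L[ℝ] ℝ) (x : E4) (b : ℝ), ContDiffAt ℝ 2 g x →
      (∀ᶠ y in 𝓝 x, ∀ v w : E4, g y v w = g y w v) → ‖g x - Minkowski.bilin‖ ≤ 1 / 2 →
      (∀ v : E4, ‖fderiv ℝ g x v‖ ≤ b * ‖v‖) →
      ∀ μ ν : Fin 4, |metricDet g x * pseudotensor g x μ ν| ≤ Cp * b ^ 2)
    {g : E4 → E4 →L[ℝ] E4 →L[ℝ] ℝ} {W : Set E4} (hWo : IsOpen W) (hgW : ContDiffOn ℝ ∞ g W)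
    (hsymm : ∀ x ∈ W, ∀ v w : E4, g x v w = g x w v) (hric : ∀ x ∈ W, MetricCoord.ricAt g x = 0)
    {t : ℝ} {c : E3} {R ρ₀ : ℝ} {m : ℕ} {c' : Fin m → E3} {R' : Fin m → ℝ} (hρ₀ : 0 < ρ₀) (hR : 0 < R)
    (hR' : ∀ k, 0 < R' k) (hin : ∀ k, dist (c' k) c + R' k < R)
    (hdisj : ∀ k l, k ≠ l → R' k + R' l < dist (c' k) (c' l))
    (hfar : ∀ y : E3, dist y c ≤ R → (∀ k, R' k ≤ dist y (c' k)) → ∀ i, ρ₀ ≤ ‖y - ξ i t‖)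
    (hpt : ∀ y : E3, dist y c ≤ R → (∀ k, R' k ≤ dist y (c' k)) → E4.ofTimeSpace t y ∈ W ∧
      ‖g (E4.ofTimeSpace t y) - Minkowski.bilin‖ ≤ 1 / 2 ∧
      ∀ v : E4, ‖fderiv ℝ g (E4.ofTimeSpace t y) v‖ ≤ K * ((⨅ i, ‖y - ξ i t‖) ^ (7 / 4 : ℝ))⁻¹ * ‖v‖)
    (μ : Fin 4) :
    |quasiLocalMomentum g t c R μ - ∑ k, quasiLocalMomentum g t (c' k) (R' k) μ| ≤
      Cp * K ^ 2 * N * (8 * Real.pi * ρ₀ ^ (-(1 / 2) : ℝ)) := by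
  haveI : Nonempty (Fin N) := ⟨⟨0, hN⟩⟩
  -- the region where the field is regular with nondegenerate Gram matrix
  set W' : Set E4 := W ∩ (fun x ↦ metricDet g x) ⁻¹' ({0}ᶜ : Set ℝ) with hW'def
  have hW'o : IsOpen W' :=
    (contDiffOn_metricDet hgW).continuousOn.isOpen_inter_preimage hWo isOpen_compl_singleton
  have hg' : ContDiffOn ℝ ∞ g W' := hgW.mono inter_subset_left
  have hdet' : ∀ x ∈ W', metricDet g x ≠ 0 := fun x hx ↦ hx.2
  have hmemW' : ∀ y : E3, dist y c ≤ R → (∀ k, R' k ≤ dist y (c' k)) → E4.ofTimeSpace t y ∈ W' :=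
    fun y hy hk ↦ ⟨(hpt y hy hk).1, metricDet_ne_zero (hpt y hy hk).2.1⟩
  -- the perforated Gauss law and the bulk bound
  rw [LLGauss.perforatedGauss hW'o hg' hdet' (t := t) hR hR' hin hdisj hmemW' μ]
  refine abs_setIntegral_le_of_decay (fun i ↦ ξ i t) hρ₀ (L := Cp * K ^ 2) (by positivity)
    (LLGauss.isCompact_perforated c R c' R').isClosed.measurableSet (fun y hy i ↦ hfar y hy.1 hy.2 i)
    (fun y hy ↦ ?_)
  obtain ⟨hyW, hyη, hyb⟩ := hpt y hy.1 hy.2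
  have hg2 : ContDiffAt ℝ 2 g (E4.ofTimeSpace t y) :=
    (hgW.contDiffAt (hWo.mem_nhds hyW)).of_le (by norm_cast)
  have hsym : ∀ᶠ z in 𝓝 (E4.ofTimeSpace t y), ∀ v w : E4, g z v w = g z w v :=
    Filter.eventually_of_mem (hWo.mem_nhds hyW) fun z hz ↦ hsymm z hz
  refine (abs_emComplex_le_of_pseudotensorBound hPTB hg2 hsym hyη hyb (hric _ hyW) μ 0).trans ?_
  have hd0 : 0 < ⨅ i, ‖y - ξ i t‖ := hρ₀.trans_le (le_ciInf (hfar y hy.1 hy.2))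
  rw [mul_pow, inv_rpow_seven_fourths_sq hd0, mul_assoc]
  exact mul_le_mul_of_nonneg_left
    (mul_le_mul_of_nonneg_left (rpow_iInf_norm_sub_le_sum hN _ y) (sq_nonneg K)) hCp0

/-- **Geometry of the clean excision**: every point of the perforated region between a `δ`-admissible
window `(c, R)` and `δ`-admissible sub-windows `(c′ₖ, R′ₖ)` of radii `≥ Rm`, which carry every centre
inside the big window, is at distance `≥ δ Rm` from every centre. [folklore] -/
theorem le_norm_sub_of_perforated {N m : ℕ} {ζ : Fin N → E3} {c : E3} {R Rm δ : ℝ} {c' : Fin m → E3}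
    {R' : Fin m → ℝ} (hδ : 0 ≤ δ) (hRmR : Rm ≤ R) (hRmR' : ∀ k, Rm ≤ R' k)
    (hclean : ∀ j, ‖ζ j - c‖ ≤ (1 - δ) * R ∨ (1 + δ) * R ≤ ‖ζ j - c‖)
    (hcover : ∀ j, ‖ζ j - c‖ ≤ (1 - δ) * R → ∃ k, ‖ζ j - c' k‖ ≤ (1 - δ) * R' k)
    {y : E3} (hy : dist y c ≤ R) (hk : ∀ k, R' k ≤ dist y (c' k)) (j : Fin N) : δ * Rm ≤ ‖y - ζ j‖ := by
  rw [dist_eq_norm] at hy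
  rcases hclean j with hj | hj
  · obtain ⟨k, hk'⟩ := hcover j hj
    have h1 := hk k
    rw [dist_eq_norm] at h1
    have h2 : ‖y - c' k‖ ≤ ‖y - ζ j‖ + ‖ζ j - c' k‖ := norm_sub_le_norm_sub_add_norm_sub _ _ _
    have h3 : δ * Rm ≤ δ * R' k := mul_le_mul_of_nonneg_left (hRmR' k) hδ
    linarith
  · have h2 : ‖ζ j - c‖ ≤ ‖ζ j - y‖ + ‖y - c‖ := norm_sub_le_norm_sub_add_norm_sub _ _ _
    rw [norm_sub_rev (ζ j) y] at h2
    have h3 : δ * Rm ≤ δ * R := mul_le_mul_of_nonneg_left hRmR hδ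
    linarith

/-- **EXC · CLEAN EXCISION WITH A RATE IN SCALE for the lab charges** (see the module docstring):
hypotheses verbatim those of the proved identification; at equal times, for a `δ`-admissible window
`(c, R)` in the middle cone and finitely many `δ`-admissible sub-windows nested in it, pairwise
`(1 + δ)`-separated, all radii `≥ Rm ≥ ρ(t)/δ`, carrying all members of the big window,
`|P(t; c, R) − Σₖ P(t; c′ₖ, R′ₖ)| ≤ C · (√Rm)⁻¹`. [cite: LandauLifshitz1975, §96 (96.16)–(96.17)] -/
theorem stub_cleanExcision :
        (∃ C : ℝ, 0 ≤ C ∧ ∀ (g : E4 → E4 →L[ℝ] E4 →L[ℝ] ℝ) (x : E4) (b : ℝ), ContDiffAt ℝ 2 g x → (∀ᶠ y in 𝓝 x, ∀ v w : E4, g y v w = g y w v) → ‖g x - Minkowski.bilin‖ ≤ 1 / 2 → (∀ v : E4, ‖fderiv ℝ g x v‖ ≤ b * ‖v‖) → ∀ μ ν : Fin 4, |LandauLifshitz.metricDet g x * LandauLifshitz.pseudotensor g x μ ν| ≤ C * b ^ 2) →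
    ∀ (X : Type) [TopologicalSpace X] [ChartedSpace E3 X] [IsManifold (𝓡 3) ((⊤ : ℕ∞) : WithTop ℕ∞) X] [T2Space X] [SecondCountableTopology X] [ConnectedSpace X], ∀ D ∈ admissibleVacuumData X, ∀ 𝒟 : VacuumCauchyDevelopment D, 𝒟.IsMaximal → ∀ (N : ℕ) (M a rin : Fin N → ℝ) (Λ : Fin N → ℝ → lorentzGroup) (ξ : Fin N → ℝ → E3) (γ κ τ₀ : ℝ) (U : Opens E4) (Φ : U → 𝒟.carrier) (O : Set 𝒟.carrier), ((∀ i, Kerr.IsSubextremal (M i) (a i) ∧ Kerr.rMinus (M i) (a i) < rin i ∧ rin i < Kerr.rPlus (M i) (a i)) ∧ (∀ i t, |((Λ i t : E4 ≃L[ℝ] E4) (E4.basisVector 0)) 0| ≤ γ) ∧ (∀ i, ContDiff ℝ ((⊤ : ℕ∞) : WithTop ℕ∞) (ξ i) ∧ ContDiff ℝ ((⊤ : ℕ∞) : WithTop ℕ∞) (fun t ↦ ((Λ i t : E4 ≃L[ℝ] E4) : E4 →L[ℝ] E4))) ∧ (∀ i j, i ≠ j → Tendsto (fun t ↦ ‖ξ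 i t - ξ j t‖) atTop atTop) ∧ (0 < κ ∧ κ < 1 ∧ ∀ i, ∀ᶠ t in atTop, ‖ξ i t‖ ≤ κ ^ 2 * t) ∧ ({x : E4 | τ₀ < x 0 ∧ ∀ i, rin i < Kerr.radius (a i) (poincareInv (Λ i (x 0)) (E4.ofTimeSpace (x 0) (ξ i (x 0))) x)} ⊆ (U : Set E4)) ∧ let B : ModelBackground := ⟨U, fun x ↦ Minkowski.bilin + ∑ i, (boostedKerrBilin (Λ i (x 0)) (E4.ofTimeSpace (x 0) (ξ i (x 0))) (M i) (a i) x - Minkowski.bilin), fun x ↦ x 0, E4.spatialNorm⟩; ContMDiff 𝓘(ℝ, E4) (𝓡 4) ((⊤ : ℕ∞) : WithTop ℕ∞) Φ ∧ Topology.IsOpenEmbedding ((B.lateRegion τ₀).restrict Φ) ∧ Φ '' {x : U | τ₀ < x.1 0 ∧ ∀ i, Kerr.rPlus (M i) (a i) < Kerr.radius (a i) (poincareInv (Λ i (x.1 0)) (E4.ofTimeSpace (x.1 0) (ξ i (x.1 0))) x.1)} ⊆ O ∧ Tendsto (fun t ↦ 𝒟.toSpacetime.deviationCk B Φ 3 t)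 atTop (𝓝 0) ∧ Tendsto (fun t : ℝ ↦ ⨆ x ∈ {x : U | x.1 0 = t ∧ E4.spatialNorm x.1 ≤ κ * t}, ⨆ (m : ℕ) (_ : m ≤ 3), ENNReal.ofReal (1 + √(√((⨅ i, ‖E4.spatial x.1 - ξ i t‖) ^ 7))) * ‖iteratedFDeriv ℝ m (𝒟.toSpacetime.deviationExtend B Φ) x.1‖ₑ) atTop (𝓝 0) ∧ O = Summit.FinalStateConjecture.exteriorOf 𝒟.toCauchyDevelopment (Φ '' {x : U | τ₀ < x.1 0 ∧ ∀ i, Kerr.rPlus (M i) (a i) < Kerr.radius (a i) (poincareInv (Λ i (x.1 0)) (E4.ofTimeSpace (x.1 0) (ξ i (x.1 0))) x.1)}) ∧ ∀ t₁ : ℝ, τ₀ < t₁ → O \ Φ '' {x : U | t₁ < x.1 0 ∧ ∀ i, Kerr.rPlus (M i) (a i) < Kerr.radius (a i) (poincareInv (Λ i (x.1 0)) (E4.ofTimeSpace (x.1 0) (ξ i (x.1 0))) x.1)} ⊆ 𝒟.metric.causalPast 𝒟.timeOrientation (Φ '' {x : U | x.1 0 = t₁ ∧ ∀ i, Kerr.rPlus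 (M i) (a i) < Kerr.radius (a i) (poincareInv (Λ i (x.1 0)) (E4.ofTimeSpace (x.1 0) (ξ i (x.1 0))) x.1)})) → 0 < N →
    (∀ i : Fin N, (∀ m : ℕ, 1 ≤ m → m ≤ 3 → Tendsto (fun t ↦ iteratedDeriv m (fun s ↦ (((Λ i s : lorentzGroup) : E4 ≃L[ℝ] E4) (E4.basisVector 0))) t) atTop (𝓝 0)) ∧ (∀ m : ℕ, m ≤ 2 → Tendsto (fun t ↦ iteratedDeriv m (fun s ↦ deriv (ξ i) s - (((((Λ i s : lorentzGroup) : E4 ≃L[ℝ] E4) (E4.basisVector 0)) 0)⁻¹ • E4.spatial (((Λ i s : lorentzGroup) : E4 ≃L[ℝ] E4) (E4.basisVector 0)))) t) atTop (𝓝 0)) ∧ (a i ≠ 0 → ∀ m : ℕ, 1 ≤ m → m ≤ 3 → Tendsto (fun t ↦ iteratedDeriv m (fun s ↦ (((Λ i s : lorentzGroup) : E4 ≃L[ℝ] E4) (E4.basisVector 3))) t) atTop (𝓝 0))) →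
    (∀ ρ : ℝ → ℝ, Tendsto ρ atTop atTop → Tendsto (fun t : ℝ ↦ ⨆ x ∈ {x : E4 | x 0 = t ∧ E4.spatialNorm x ≤ κ * t ∧ ρ t ≤ ⨅ i, ‖E4.spatial x - ξ i t‖}, ENNReal.ofReal (1 + √(√((⨅ i, ‖E4.spatial x - ξ i t‖) ^ 7))) * ‖fderiv ℝ (fun y : E4 ↦ Minkowski.bilin + ∑ i, (boostedKerrBilin (Λ i (y 0)) (E4.ofTimeSpace (y 0) (ξ i (y 0))) (M i) (a i) y - Minkowski.bilin)) x (E4.basisVector 0)‖ₑ) atTop (𝓝 0)) →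
    (∀ ρ : ℝ → ℝ, Tendsto ρ atTop atTop → ∀ δ : ℝ, 0 < δ → δ < 1 → ∃ (C T : ℝ), ∀ (t : ℝ) (c : E3) (R Rm : ℝ) (m : ℕ) (c' : Fin m → E3) (R' : Fin m → ℝ), T ≤ t → 0 < Rm → ρ t ≤ δ * Rm → Rm ≤ R → (∀ k, Rm ≤ R' k) → ‖c‖ + R ≤ (κ + κ ^ 2) / 2 * t → (∀ j, ‖ξ j t - c‖ ≤ (1 - δ) * R ∨ (1 + δ) * R ≤ ‖ξ j t - c‖) → (∀ k j, ‖ξ j t - c' k‖ ≤ (1 - δ) * R' k ∨ (1 + δ) * R' k ≤ ‖ξ j t - c' k‖) → (∀ k, ‖c' k - c‖ + (1 + δ) * R' k ≤ (1 - δ) * R) → (∀ k l, k ≠ l → (1 + δ) * (R' k + R' l) ≤ ‖c' k - c' l‖) → (∀ j, ‖ξ j t - c‖ ≤ (1 - δ) * R → ∃ k, ‖ξ j t - c' k‖ ≤ (1 - δ) * R' k) → ∀ μ : Fin 4, |(LandauLifshitz.quasiLocalMomentum (fun x : E4 ↦ (Minkowski.bilin + ∑ i, (boostedKerrBilin (Λ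 i (x 0)) (E4.ofTimeSpace (x 0) (ξ i (x 0))) (M i) (a i) x - Minkowski.bilin)) + 𝒟.toSpacetime.deviationExtend (⟨U, fun x ↦ Minkowski.bilin + ∑ i, (boostedKerrBilin (Λ i (x 0)) (E4.ofTimeSpace (x 0) (ξ i (x 0))) (M i) (a i) x - Minkowski.bilin), fun x ↦ x 0, E4.spatialNorm⟩ : ModelBackground) Φ x)) t c R μ - ∑ k, (LandauLifshitz.quasiLocalMomentum (fun x : E4 ↦ (Minkowski.bilin + ∑ i, (boostedKerrBilin (Λ i (x 0)) (E4.ofTimeSpace (x 0) (ξ i (x 0))) (M i) (a i) x - Minkowski.bilin)) + 𝒟.toSpacetime.deviationExtend (⟨U, fun x ↦ Minkowski.bilin + ∑ i, (boostedKerrBilin (Λ i (x 0)) (E4.ofTimeSpace (x 0) (ξ i (x 0))) (M i) (a i) x - Minkowski.bilin), fun x ↦ x 0, E4.spatialNorm⟩ : ModelBackground) Φ x)) t (c' k) (R' k) μ| ≤ C * (√Rm)⁻¹) := by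
  intro hPTB X _ _ _ _ _ _ D _ 𝒟 _ N M a rin Λ ξ γ κ τ₀ U Φ O hL hN _ hQ ρ hρ δ hδ0 _
  classical
  obtain ⟨Cp, hCp0, hPTB⟩ := hPTB
  obtain ⟨hsub, hγ, hsmooth, -, hκ, hU, hrest⟩ := hL
  obtain ⟨hΦ, -, -, -, hWt, -, -⟩ := hrest
  set Gb : E4 → E4 →L[ℝ] E4 →L[ℝ] ℝ := fun x ↦ Minkowski.bilin + ∑ i, (boostedKerrBilin (Λ i (x 0)) (E4.ofTimeSpace (x 0) (ξ i (x 0))) (M i) (a i) x - Minkowski.bilin) with hGbdef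
  set B : ModelBackground := ⟨U, Gb, fun x ↦ x 0, E4.spatialNorm⟩ with hBdef
  set dev : E4 → E4 →L[ℝ] E4 →L[ℝ] ℝ := 𝒟.toSpacetime.deviationExtend B Φ with hdevdef
  set lab : E4 → E4 →L[ℝ] E4 →L[ℝ] ℝ := fun x ↦ Gb x + dev x with hlabdef
  -- (0) basic facts
  have hrin : ∀ i, 0 ≤ rin i := fun i ↦ (hsub i).1.rMinus_nonneg.trans (hsub i).2.1.le
  have hΛ : ∀ i, ContDiff ℝ ∞ (fun t ↦ ((Λ i t : E4 ≃L[ℝ] E4) : E4 →L[ℝ] E4)) := fun i ↦ (hsmooth i).2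
  have hξ : ∀ i, ContDiff ℝ ∞ (ξ i) := fun i ↦ (hsmooth i).1
  have hRic : ∀ [𝒟.toSpacetime.metric.toPseudoRiemannianMetric.HasLeviCivita],
      𝒟.toSpacetime.metric.toPseudoRiemannianMetric.IsRicciFlat := 𝒟.isRicciFlat
  obtain ⟨hκ0, hκ1, -⟩ := hκ
  haveI : Nonempty (Fin N) := ⟨⟨0, hN⟩⟩
  -- (1) the far-field control of the lab metric beyond `ρ`, and the region where it is regular
  obtain ⟨Tsc, K, -, hsc⟩ := ChargeModel.sphereConditions 𝒟.toSpacetime M a rin Λ ξ γ κ τ₀ U Φ hrin hγ hΛ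
    hξ hU hΦ hWt hQ ρ hρ
  obtain ⟨hWopen, hWsmooth, hWsymm, hWric⟩ := ChargeModel.labRegion_props 𝒟.toSpacetime B Φ hΦ hRic
  -- (2) the constant and the starting time
  refine ⟨Cp * K ^ 2 * N * (8 * Real.pi) * δ ^ (-(1 / 2) : ℝ), max Tsc 0, ?_⟩
  intro t c R Rm m c' R' hTt hRm hρRm hRmR hRmR' hcR hclean _ hnest hsep hcover μ
  have hT1 : Tsc ≤ t := (le_max_left _ _).trans hTt
  have ht0 : 0 ≤ t := (le_max_right _ _).trans hTt
  have hR0 : 0 < R := hRm.trans_le hRmR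
  have hR'0 : ∀ k, 0 < R' k := fun k ↦ hRm.trans_le (hRmR' k)
  have hρ₀0 : 0 < δ * Rm := mul_pos hδ0 hRm
  -- (3) the holes are strictly inside the window and strictly disjoint
  have hin : ∀ k, dist (c' k) c + R' k < R := fun k ↦ by
    have h1 := hnest k
    have h2 := mul_pos hδ0 (hR'0 k)
    have h3 := mul_pos hδ0 hR0
    rw [dist_eq_norm]
    linarith
  have hdisj : ∀ k l, k ≠ l → R' k + R' l < dist (c' k) (c' l) := fun k l hkl ↦ by
    have h1 := hsep k l hkl
    have h2 := mul_pos hδ0 (hR'0 k)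
    have h3 := mul_pos hδ0 (hR'0 l)
    rw [dist_eq_norm]
    linarith
  -- (4) the perforated region is `δ Rm`-clear of the centres and inside the cone
  have hfar : ∀ y : E3, dist y c ≤ R → (∀ k, R' k ≤ dist y (c' k)) → ∀ j, δ * Rm ≤ ‖y - ξ j t‖ :=
    fun y hy hk j ↦ le_norm_sub_of_perforated (ζ := fun j ↦ ξ j t) hδ0.le hRmR hRmR' hclean hcover hy hk j
  have hcone : ∀ y : E3, dist y c ≤ R → ‖y‖ ≤ κ * t := fun y hy ↦
    SublinearIsFree.ChargeModel.norm_le_cone_of_window hy hcR hκ0.le hκ1.le ht0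
  have hpt : ∀ y : E3, dist y c ≤ R → (∀ k, R' k ≤ dist y (c' k)) →
      E4.ofTimeSpace t y ∈ {x : E4 | x ∈ (B.domain : Set E4) ∧
        ‖(B.bilin x + 𝒟.toSpacetime.deviationExtend B Φ x) - Minkowski.bilin‖ < 1} ∧
      ‖lab (E4.ofTimeSpace t y) - Minkowski.bilin‖ ≤ 1 / 2 ∧
      ∀ v : E4, ‖fderiv ℝ lab (E4.ofTimeSpace t y) v‖ ≤ K * ((⨅ i, ‖y - ξ i t‖) ^ (7 / 4 : ℝ))⁻¹ * ‖v‖ :=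
    fun y hy hk ↦ hsc t y hT1 (hcone y hy) (le_ciInf fun i ↦ hρRm.trans (hfar y hy hk i))
  -- (5) the excision estimate, and the bookkeeping of the constant
  have key := excision_estimate hN ξ hCp0 hPTB (g := lab) hWopen hWsmooth hWsymm hWric hρ₀0 hR0 hR'0
    hin hdisj hfar hpt μ
  refine key.trans (le_of_eq ?_)
  rw [Real.mul_rpow hδ0.le hRm.le, Real.sqrt_eq_rpow, Real.rpow_neg hRm.le]
  ring

/-- Registered one-line form (carrier `cleanExcision_clear_sce12` of the crux item) of
`le_norm_sub_of_perforated`: the perforated region of a clean excision is `δ Rm`-clear of every centre.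
[folklore] -/
theorem cleanExcision_clear_sce12 : open Literature.Geometry.Lorentzian in ∀ {N m : ℕ} {ζ : Fin N → E3} {c : E3} {R Rm δ : ℝ} {c' : Fin m → E3} {R' : Fin m → ℝ}, 0 ≤ δ → Rm ≤ R → (∀ k, Rm ≤ R' k) → (∀ j, ‖ζ j - c‖ ≤ (1 - δ) * R ∨ (1 + δ) * R ≤ ‖ζ j - c‖) → (∀ j, ‖ζ j - c‖ ≤ (1 - δ) * R → ∃ k, ‖ζ j - c' k‖ ≤ (1 - δ) * R' k) → ∀ {y : E3}, dist y c ≤ R → (∀ k, R' k ≤ dist y (c' k)) → ∀ j : Fin N, δ * Rm ≤ ‖y - ζ j‖ :=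
  fun hδ hRmR hRmR' hclean hcover _ hy hk j ↦ le_norm_sub_of_perforated hδ hRmR hRmR' hclean hcover hy hk j

end Summit.FinalStateConjecture.FinalStateConjecture.Theorems.SketchCleanExcision

end
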